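import Mathlib
import Summits.Ventures.HodgeRepro.Tier4.Target
import Summits.Ventures.HodgeRepro.Tier4.Common.TargetBall
import Summits.Ventures.HodgeRepro.Tier4.Common.TargetCalculus
import Summits.Ventures.HodgeRepro.Tier4.Common.TargetJacobian
import Summits.Ventures.HodgeRepro.Tier4.Common.TargetData
import Summits.Ventures.HodgeRepro.Tier4.Common.ProperlyDiscontinuous
import Summits.Ventures.HodgeRepro.Tier4.LitCompactness
import Summits.Ventures.HodgeRepro.Tier4.Line3.BallChangeOfVariables
import Summits.Ventures.HodgeRepro.Tier4.Negative.NormaliserDomain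
import Summits.Ventures.HodgeRepro.Tier4.Line4.MixedTransfer
import Summits.Ventures.HodgeRepro.Tier4.Line4.MixedInvariant
import Summits.Ventures.HodgeRepro.Tier4.Line4.Cohomology11
import Summits.Ventures.HodgeRepro.Tier4.Line4.MixedClosed
import Summits.Ventures.HodgeRepro.Tier4.Line4.PairIndependent

/-!
# Tier 4 · Negative — `TwistObstruction` (SIGNATURE FILE; sorries = the four statements; never to be proposed)

The KERNEL HALF of the cell's negation probe (lead g385 RULINGS III S12912 R-I(c), RULINGS IV S12981 R-III):
(T1) a finite-order normaliser `γ` of the level with an eigen-action on the four translated coordinate functions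
whose eigenvalue product is `≠ 1` kills the target's integral; (T2) `TwistedInstance` — a datum satisfying EVERY
binder of `P_T4` (a `TargetData F E`, the twisted member of the paper side (α)–(δ)) with such a `γ` for EVERY deeper
level and EVERY Hecke family — and `not_P_T4_of_twistedInstance : TwistedInstance → ¬ P_T4`.

WHAT IS DISPLAYED, BY NAME.  N1 is consumed in L1-p3's `Negative.isFundamentalDomainFor_image_actM_of_unitaryJ`
form (the image form, with the unitarity `(toBallMat τ₀ C γ)ᴴ * J * toBallMat τ₀ C γ = J` as the hypothesis; derived
from `IsUnitaryOf` + `IsSylvester` by `isFundamentalDomainFor_image_actM`); N2 = `Negative.jacDet_comp_actM`; the change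
of variables = L3-p1's `Line3.integral_image_actM`; the DOMAIN INDEPENDENCE of the target's pairing for the
`Γ′`-invariant density = `Line4.pair11_domain_independent` (p670765) through `Line4.pairing_eq_neg_mixedPairing`,
under the two Borel–Harish-Chandra Props: `hP` discharged by name (`properlyDiscontinuous_hdef_holds`), `hK`
(cocompactness, BHC 1962 Thm 11.8) a DISPLAYED clause of `TwistedInstance`.  `TwistedInstance` is a hypothesis-free
instance of `P_T4`'s binders (the twisted member); `P_T4v2`'s inserted hypothesis `hN2` FAILS on it (`γ` = the
3-torsion realisation, `χ₁χ₂/(χ₃χ₄) = ε′(z₁) ≠ 1`) — that is the record's link between this refutation and v2; no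
Lean about v2 is in this file.  HC_CM is NOT proved by anyone in this repository.
-/

set_option autoImplicit false

noncomputable section

namespace Summit.Ventures.HodgeRepro.Tier4.Negative

open Summit.Ventures.HodgeRepro.Tier4.Line4 Summit.Ventures.HodgeRepro.Tier4.Line3 Matrix MeasureTheory NumberField
open scoped ComplexConjugate

section Abstract

variable {E : Type*} [Field E] {c : E ≃+* E} {H : Matrix (Fin 3) (Fin 3) E} {τ₀ : E →+* ℂ}
  {C : Matrix (Fin 3) (Fin 3) ℂ} {Γ' : Set (Matrix (Fin 3) (Fin 3) E)}

/-- A function equal to `a * u + b` on the open ball has partial derivatives `a * ∂u` there. -/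
theorem pd_of_eqOn_ball {u v : (Fin 2 → ℂ) → ℂ} (hu : DifferentiableOn ℂ u ball) {a b : ℂ}
    (hv : ∀ w ∈ ball, v w = a * u w + b) {z : Fin 2 → ℂ} (hz : z ∈ ball) (k : Fin 2) :
    pd k v z = a * pd k u z := by
  have hnhds : ball ∈ nhds z := isOpen_ball.mem_nhds hz
  have heq : v =ᶠ[nhds z] fun w => a * u w + b := Filter.eventually_of_mem hnhds hv
  simp only [pd]
  rw [heq.fderiv_eq, fderiv_add_const, fderiv_const_mul (hu.differentiableAt hnhds)]
  simp

/-- The Jacobian of two functions equal to `a * u + b`, `a' * u' + b'` on the ball scales by `a * a'`. -/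
theorem jacDet_eigen_of_eqOn_ball {u u' v v' : (Fin 2 → ℂ) → ℂ} (hu : DifferentiableOn ℂ u ball)
    (hu' : DifferentiableOn ℂ u' ball) {a b a' b' : ℂ} (hv : ∀ w ∈ ball, v w = a * u w + b)
    (hv' : ∀ w ∈ ball, v' w = a' * u' w + b') {z : Fin 2 → ℂ} (hz : z ∈ ball) :
    jacDet v v' z = a * a' * jacDet u u' z := by
  simp only [jacDet, wedge]
  rw [pd_of_eqOn_ball hu hv hz, pd_of_eqOn_ball hu hv hz, pd_of_eqOn_ball hu' hv' hz,
    pd_of_eqOn_ball hu' hv' hz]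
  ring

/-- **(T1) `integral_eq_zero_of_normaliser_eigen`.**  `γ` acts on the ball (`hMγ`: `toBallMat τ₀ C γ ∈ U(2,1)`, from `IsUnitaryOf` by
`toBallMat_J`), `D` is a fundamental domain, the four functions `u i` are holomorphic on the ball and satisfy the eigen-property
`u i ∘ act γ = c i • u i + k i` ON THE BALL (crit-1 S12964: constants allowed, never a function equality on `ℂ²`), with
`c 0 * c 1 * conj (c 2 * c 3) ≠ 1`; `hdom` is the domain independence of the integral for the two fundamental domains
`D` and `act γ '' D` (discharged for the target's density in `pairing_domain_independent`).  Then the target's integral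
vanishes: `∫_{γD} f = ∫_D f` (hdom) and `∫_{γD} f = c₀c₁ conj(c₂c₃) ∫_D f` (N2 + change of variables).  N1 (the
normaliser condition) enters only where `hdom` is discharged: `γ '' D` must be a fundamental domain
(`conclusion_false_of_isTwisted`). -/
theorem integral_eq_zero_of_normaliser_eigen {γ : Matrix (Fin 3) (Fin 3) E}
    (hMγ : (toBallMat τ₀ C γ)ᴴ * J * toBallMat τ₀ C γ = J)
    {D : Set (Fin 2 → ℂ)} (hD : IsFundamentalDomainFor (ballActions τ₀ C Γ') D)
    (u : Fin 4 → (Fin 2 → ℂ) → ℂ) (hu : ∀ i, DifferentiableOn ℂ (u i) ball) (cc kk : Fin 4 → ℂ)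
    (heig : ∀ i, ∀ z ∈ ball, u i (actM (toBallMat τ₀ C γ) z) = cc i * u i z + kk i)
    (hc : cc 0 * cc 1 * conj (cc 2 * cc 3) ≠ 1)
    (hdom : ∫ z in actM (toBallMat τ₀ C γ) '' D, jacDet (u 0) (u 1) z * conj (jacDet (u 2) (u 3) z) =
      ∫ z in D, jacDet (u 0) (u 1) z * conj (jacDet (u 2) (u 3) z)) :
    ∫ z in D, jacDet (u 0) (u 1) z * conj (jacDet (u 2) (u 3) z) = 0 := by
  set M := toBallMat τ₀ C γ with hMdef
  set f : (Fin 2 → ℂ) → ℂ := fun z => jacDet (u 0) (u 1) z * conj (jacDet (u 2) (u 3) z) with hf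
  set cst : ℂ := cc 0 * cc 1 * conj (cc 2 * cc 3) with hcst
  have hDm : MeasurableSet D := hD.1
  have hDb : D ⊆ ball := hD.2.1
  -- the pulled-back Jacobians scale by the eigenvalues
  have hjac : ∀ i j, ∀ z ∈ ball, jacDet (u i) (u j) (actM M z) * jacDetMap (actM M) z =
      cc i * cc j * jacDet (u i) (u j) z := by
    intro i j z hz
    have hMz : actM M z ∈ ball := actM_mem_ball hMγ hz
    have hcomp := jacDet_comp_actM hMγ hz ((hu i).differentiableAt (isOpen_ball.mem_nhds hMz))
      ((hu j).differentiableAt (isOpen_ball.mem_nhds hMz))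
    rw [jacDetMap_actM M z (mulVec_lift3_two_ne_zero hMγ hz), ← hcomp]
    exact jacDet_eigen_of_eqOn_ball (hu i) (hu j) (heig i) (heig j) hz
  -- the density transforms by the constant `cst`
  have hdens : ∀ z ∈ D, (Complex.normSq (jacDetMap (actM M) z) : ℂ) * f (actM M z) = cst * f z := by
    intro z hz
    have hz' : z ∈ ball := hDb hz
    simp only [hf, hcst]
    rw [Complex.normSq_eq_conj_mul_self]
    have h01 := hjac 0 1 z hz'
    have h23 := hjac 2 3 z hz'
    calc conj (jacDetMap (actM M) z) * jacDetMap (actM M) z *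
          (jacDet (u 0) (u 1) (actM M z) * conj (jacDet (u 2) (u 3) (actM M z)))
        = (jacDet (u 0) (u 1) (actM M z) * jacDetMap (actM M) z) *
            conj (jacDet (u 2) (u 3) (actM M z) * jacDetMap (actM M) z) := by
          rw [map_mul]; ring
      _ = cc 0 * cc 1 * conj (cc 2 * cc 3) * (jacDet (u 0) (u 1) z * conj (jacDet (u 2) (u 3) z)) := by
          rw [h01, h23, map_mul, map_mul]; ring
  have hcov : ∫ z in actM M '' D, f z = cst * ∫ z in D, f z := by
    rw [integral_image_actM hMγ hDm hDb f, ← integral_const_mul]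
    exact setIntegral_congr_fun hDm hdens
  have hI : ∫ z in D, f z = cst * ∫ z in D, f z := by
    rw [← hcov]; exact hdom.symm
  have hc' : cst ≠ 1 := hc
  have : (cst - 1) * ∫ z in D, f z = 0 := by rw [sub_mul, one_mul, ← hI, sub_self]
  exact (mul_eq_zero.mp this).resolve_left (sub_ne_zero.mpr hc')

end Abstract

section Datum

variable {F : Type} {E : Type} [Field F] [NumberField F] [IsGalois ℚ F] [IsCMField F]
  [Field E] [NumberField E] [IsGalois ℚ E] [IsCMField E] (d : TargetData F E)

/-- The target's pairing `d.pairing D h = ∫_D jac_s · conj jac_{s̄}` does not depend on the fundamental domain `D` of the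
level `Γ′`: `pairing_eq_neg_mixedPairing` + `pair11_domain_independent` (hK, hP displayed; hP is a theorem by name). -/
theorem pairing_domain_independent (hK : Lit.BorelHarishChandra1962_Thm11_8_cocompact_hdef E d.H d.τ₀ d.C)
    (hP : Lit.BorelHarishChandra1962_properlyDiscontinuous_hdef E d.H d.τ₀ d.C)
    (Γ' : Set (Matrix (Fin 3) (Fin 3) E)) (hΓ' : d.IsLevel Γ') (h : Fin 4 → HeckeElement E)
    (hh : d.IsHeckeFor Γ' h) (D D' : Set (Fin 2 → ℂ)) (hD : d.IsDomain Γ' D) (hD' : d.IsDomain Γ' D') :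
    d.pairing D h = d.pairing D' h := by
  have hmem : ∀ ξ : Forms11, Smooth11 ξ → IsClosed11 ξ → IsInvariant11 d Γ' ξ → onBall ξ ∈ Z11 d Γ' :=
    fun ξ hs hc hi => Submodule.subset_span ⟨ξ, hs, hc, hi, rfl⟩
  have hξ : onBall (ξ₁₃ d h) ∈ Z11 d Γ' :=
    hmem _ (mixed_smooth d Γ' hΓ' h hh).1 (mixed_closed d Γ' hΓ' h hh).1 (mixed_invariant d Γ' hΓ' h hh).1
  have hξ' : onBall (ξ₂₄ d h) ∈ Z11 d Γ' :=
    hmem _ (mixed_smooth d Γ' hΓ' h hh).2 (mixed_closed d Γ' hΓ' h hh).2 (mixed_invariant d Γ' hΓ' h hh).2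
  have hpair : ∀ D₀ : Set (Fin 2 → ℂ), d.IsDomain Γ' D₀ →
      d.pairing D₀ h = -pair11 D₀ (onBall (ξ₁₃ d h)) (onBall (ξ₂₄ d h)) := by
    intro D₀ hD₀
    rw [pairing_eq_neg_mixedPairing d D₀ h]
    congr 1
    refine setIntegral_congr_fun hD₀.1 fun z hz => ?_
    rw [onBall_apply_of_mem _ (hD₀.2.1 hz), onBall_apply_of_mem _ (hD₀.2.1 hz)]
  rw [hpair D hD, hpair D' hD', pair11_domain_independent d hK hP Γ' hΓ' D D' hD hD' _ _ hξ hξ']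

/-- **(T2) the twist property of a datum**: for EVERY deeper level `Γ′` and EVERY Hecke family `h` of that level some
`γ ∈ U(H)(E)` normalising `Γ′` acts on the four translated coordinate functions `u₁ d h … u₄ d h` (= the target's
`comp (T i) _ _ (heckeTranslate τ₀ C (h i) (a i))`, `MixedTransfer`) by `u ∘ act γ = c • u + k` on the ball with
`c₁ c₂ conj(c₃ c₄) ≠ 1`.  This is the paper side (α)–(δ) of the negation probe, displayed and never hidden. -/
def IsTwisted : Prop :=
  ∀ Γ' : Set (Matrix (Fin 3) (Fin 3) E), d.IsLevel Γ' → ∀ h : Fin 4 → HeckeElement E, d.IsHeckeFor Γ' h →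
    ∃ γ : Matrix (Fin 3) (Fin 3) E, IsUnitaryOf (conjE E) d.H γ ∧ (∀ g, g ∈ Γ' ↔ γ * g * γ⁻¹ ∈ Γ') ∧
      ∃ cc kk : Fin 4 → ℂ,
        (∀ z ∈ ball, u₁ d h (d.act γ z) = cc 0 * u₁ d h z + kk 0) ∧
        (∀ z ∈ ball, u₂ d h (d.act γ z) = cc 1 * u₂ d h z + kk 1) ∧
        (∀ z ∈ ball, u₃ d h (d.act γ z) = cc 2 * u₃ d h z + kk 2) ∧
        (∀ z ∈ ball, u₄ d h (d.act γ z) = cc 3 * u₄ d h z + kk 3) ∧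
        cc 0 * cc 1 * conj (cc 2 * cc 3) ≠ 1

/-- A twisted datum (with the cocompactness Prop `hK`) has NO non-zero pairing at any level: `¬ d.conclusion`. -/
theorem conclusion_false_of_isTwisted (hK : Lit.BorelHarishChandra1962_Thm11_8_cocompact_hdef E d.H d.τ₀ d.C)
    (hT : IsTwisted d) : ¬ d.conclusion := by
  rintro ⟨Γ', hΓc, hsub, h, hh, D, hD, hne⟩
  have hΓ' : d.IsLevel Γ' := ⟨hΓc, hsub⟩
  have hh' : d.IsHeckeFor Γ' h := hh
  obtain ⟨γ, hγ, hnorm, cc, kk, h1, h2, h3, h4, hc⟩ := hT Γ' hΓ' h hh'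
  have hτ : ∀ x, d.τ₀ (conjE E x) = conj (d.τ₀ x) := hτ_of_datum d
  have hMγ : (toBallMat d.τ₀ d.C γ)ᴴ * J * toBallMat d.τ₀ d.C γ = J := toBallMat_J d.τ₀ (conjE E) hτ d.hC hγ
  have hD' : IsFundamentalDomainFor (ballActions d.τ₀ d.C Γ') (actM (toBallMat d.τ₀ d.C γ) '' D) :=
    isFundamentalDomainFor_image_actM_of_unitaryJ hΓc hτ d.hC hMγ hnorm hD
  have hP : Lit.BorelHarishChandra1962_properlyDiscontinuous_hdef E d.H d.τ₀ d.C :=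
    properlyDiscontinuous_hdef_holds E d.H d.τ₀ d.C
  have hdom : d.pairing (actM (toBallMat d.τ₀ d.C γ) '' D) h = d.pairing D h :=
    pairing_domain_independent d hK hP Γ' hΓ' h hh' _ D hD' hD
  let u : Fin 4 → (Fin 2 → ℂ) → ℂ := ![u₁ d h, u₂ d h, u₃ d h, u₄ d h]
  have hu : ∀ i, DifferentiableOn ℂ (u i) ball := by
    intro i
    fin_cases i
    · exact differentiableOn_u₁ d hΓ' hh'
    · exact differentiableOn_u₂ d hΓ' hh'
    · exact differentiableOn_u₃ d hΓ' hh'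
    · exact differentiableOn_u₄ d hΓ' hh'
  have heig : ∀ i, ∀ z ∈ ball, u i (actM (toBallMat d.τ₀ d.C γ) z) = cc i * u i z + kk i := by
    intro i z hz
    fin_cases i
    · exact h1 z hz
    · exact h2 z hz
    · exact h3 z hz
    · exact h4 z hz
  have hzero := integral_eq_zero_of_normaliser_eigen (Γ' := Γ') hMγ hD u hu cc kk heig hc hdom
  exact hne hzero

end Datum

/-- **`TwistedInstance`**: some datum satisfying EVERY binder of `P_T4` (a `TargetData F E` — the twisted member of the
paper side, hypothesis-free as an instance of the binders) is twisted (`IsTwisted`) and its ball quotient is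
cocompact (`hK`, Borel–Harish-Chandra 1962 Thm 11.8, a printed theorem displayed as a Prop).  `P_T4v2`'s inserted
hypothesis `hN2` FAILS on this member (`γ` = the 3-torsion realisation, `χ₁χ₂/(χ₃χ₄) = ε′(z₁) ≠ 1`). -/
def TwistedInstance : Prop :=
  ∃ (F E : Type) (_ : Field F) (_ : NumberField F) (_ : IsGalois ℚ F) (_ : IsCMField F)
    (_ : Field E) (_ : NumberField E) (_ : IsGalois ℚ E) (_ : IsCMField E) (d : TargetData F E),
    Lit.BorelHarishChandra1962_Thm11_8_cocompact_hdef E d.H d.τ₀ d.C ∧ IsTwisted d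

/-- **The kernel half of the negation probe**: a twisted instance refutes `P_T4` AS TYPED (`P_T4_iff_forall` +
`conclusion_false_of_isTwisted`). -/
theorem not_P_T4_of_twistedInstance (h : TwistedInstance) : ¬ P_T4 := by
  intro hP4
  obtain ⟨F, E, _, _, _, _, _, _, _, _, d, hK, hT⟩ := h
  exact conclusion_false_of_isTwisted d hK hT ((P_T4_iff_forall.mp hP4) F E d)

end Summit.Ventures.HodgeRepro.Tier4.Negative

end

/-! ## Notes appended after acceptance (t4-L4-p2 g2, 2026-08-28T23:1xZ; the 223 lines above are byte-identical to
the accepted p673864 = HOME proofs/t4-L4-p2/Tier4/Negative/TwistObstruction.lean f200ed125281acca; no declaration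
touched — this block answers t4-crit-2 S13092 (T2-a)/(T2-c) and the lead's S13050 wording)

(T2-a) HEADER: the title's «SIGNATURE FILE; sorries = the four statements; never to be proposed» is STALE — it
described the signature file TwistObstruction-sig.lean (17d9b2a73fc2b003 · 122, 4 sorries) from which this module was
cut; THIS module is the landed, sorry-free one: 8 declarations (`pd_of_eqOn_ball`, `jacDet_eigen_of_eqOn_ball`,
`integral_eq_zero_of_normaliser_eigen`, `pairing_domain_independent`, `IsTwisted`, `conclusion_false_of_isTwisted`,
`TwistedInstance`, `not_P_T4_of_twistedInstance`), `#print axioms not_P_T4_of_twistedInstance` =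
[propext, Classical.choice, Quot.sound] (gate record p673864; crit-1 S13076, crit-2 S13092).

(T2-c) SCOPE: `IsTwisted d` captures the 3-TORSION members only — an eigen-action with eigenvalue product `≠ 1`.
The root-number members of crit-2's OBJECTION-V2-3 (S13083 (D): `X″ = (ν₀, ν₁, ν₂ε₀, ν₃ε₀)`, a quadratic
anticyclotomic twist with `L(½, ·) = 0` along the split family) have product `= 1` for every central `γ`, are NOT
`IsTwisted`, and their vanishing is a paper mechanism ((R2)-vanishing) with no Lean in the tree; the lead's erratum
S13110 reads their status as «(P) on `X″` is OPEN, not refuted».  Nothing here asserts `TwistedInstance` holds: the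
paper member is the DATA SHEET v2 (proofs/t4/L3/TWIST-MEMBER-DATASHEET-v2.md, t4-L3-p1 S13129, crit-1 S13148), for
the critics' verdict at M2.

(v2 / v3 WORDING, lead S13050): where the docstrings above say «`P_T4v2`'s inserted hypothesis `hN2` FAILS on it»,
`P_T4v2` was the CANDIDATE successor of RULINGS IV R-II (the N2 central-character compatibility as one extra binder);
it was never frozen — the lead's S13093 / INBOX L7915 ADDENDUM found the defect of `P_T4` to be the QUANTIFIER over the
lifts, the faithful successor is the quantifier repair `P_T4v3` (TARGET-V3 DRAFT v2.1, t4-typer-1 S13148, HOME only,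
unproposed), and the operator's ruling (B2)/(B3) is pending at the time of this note.  Every declaration above is
about `P_T4` AS TYPED (Target.lean 7e1ddb58699909ce · 263, frozen); the 3-torsion member violates `hN2` (crit-1 S13076
(1)) and is outside `P_T4v3`'s existential as well.  HC_CM is NOT proved by anyone in this repository. -/

/-! ## Erratum to the block above (t4-L4-p2 g2, 2026-08-28T23:3xZ; append-only — the 250 lines above are byte-identical
to the accepted p676698; asked by t4-crit-2 S13272 for the paper record)

The (T2-c) sentence «the lead's erratum S13110 reads their status as ‹(P) on `X″` is OPEN, not refuted›» cites a
SUPERSEDED erratum.  The record of reference is the lead's consolidation S13173 (= INBOX L7917), after crit-2's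
mechanism S13145 (1) (under `P_T4`'s / `P_T4v2`'s universal quantifier the translates stay in the fixed
representations, and the central-`L`-value criterion kills the toric functional at EVERY level) and crit-1's
concession S13169: «both critics sign `¬P_T4v2` on `X″` on paper modulo four inputs (T3.2 / TP1, the functional
equation, Tunnell–Saito parity at `𝔮`, (E2)); `X″` is a second PAPER falsifier of `P_T4`».  So the root-number member
`X″` is REFUTED ON PAPER, modulo those four printed inputs, with NO Lean in the tree — not «open».  Everything else in
the block stands: `X″` is not `IsTwisted` (eigenvalue product `= 1`), nothing here asserts `TwistedInstance`, and every
declaration of this file is about `P_T4` AS TYPED.  HC_CM is NOT proved by anyone in this repository. -/
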